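import Summits.BirchSwinnertonDyer.BirchSwinnertonDyer.Theorems.KolyvaginRoadThreePTMilneOfCardSq
import HarnessLib

/-!
# Milne *ADT* I Thm. 4.10(b) for every finite discrete `Γ_K`-module of prime order `p` (`p` odd)

Route `KolyvaginRoadThree`, crux `ZhangSharpFrameAtThreeHL` (stmt-BirchSwinnertonDyer-19574), PT road — the
companion of `middleExact_canonical_of_card_eq_sq` (`#M = p²`) for modules of ORDER `p` with ARBITRARY action
(e.g. `E[φ]` for a `p`-isogeny `φ`, `μₚ`, a character of order dividing `p − 1` … any): over the `p`-Sylow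
fixed field `K'' = K̄^H` of `U = ker(Γ_K → Aut M × Aut μₚ)` (`exists_fixedField_coprime_pow_mem'`) the module
becomes TRIVIAL (an automorphism of `p`-power order of a group of order `p` is the identity,
`units_apply_eq_self_of_pow_eq_one`), so Milne I 4.10(b) over `K''` is the tree's
`middleExact_canonical_of_trivial_of_card_eq` (g18), and the prime-to-`p` descent
`middleExact_canonical_of_descentData` (nine binders, all theorems) brings it down to `K`
(`middleExact_canonical_of_card_eq_prime`).  THEOREM only; no named fact; no case of BSD.

References: [MilneADT2006] I Thm. 4.10(b); [SerreGaloisCohomology1997] I §2.4.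
-/

noncomputable section

open CategoryTheory Function NumberField IsDedekindDomain Field
open scoped NumberField ContRepresentation Classical

set_option linter.dupNamespace false
set_option autoImplicit false

namespace Summit.BirchSwinnertonDyer.BirchSwinnertonDyer.Theorems.KolyvaginRoadThreePT

open Literature.NumberTheory.GaloisRepresentations Literature.NumberTheory.GaloisCohomology
open Literature.NumberTheory.GaloisRepresentations.DiscreteGaloisModule (mu MuCarrier TateDual tateDual
  unramifiedSubgroup localTatePairingZMod)
open Literature.NumberTheory.GaloisRepresentations.SemiLocal (Place)

section Main

variable {K : Type} [Field K] [NumberField K] {p : ℕ} [hp : Fact p.Prime]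
variable {M : Type} [AddCommGroup M] [TopologicalSpace M] [DiscreteTopology M] [Finite M]

attribute [local instance] absoluteGaloisGroup_compactSpace

/-- **Milne I Thm. 4.10(b) `Ker γ¹ ⊆ Im β¹` for every finite discrete `Γ_K`-module `M` of prime order
`p` (`p` odd, any action), at every finite set of places `S` off which `p` and `M` are unramified, for
THE local Tate pairings.**  Proof: over the `p`-Sylow fixed field the module is trivial
(`units_apply_eq_self_of_pow_eq_one`), where the statement is `middleExact_canonical_of_trivial_of_card_eq`;
then the prime-to-`p` descent. [cite: MilneADT2006, Ch. I, Thm. 4.10(b)] -/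
theorem middleExact_canonical_of_card_eq_prime (hodd : Odd p) (ρ : DiscreteGaloisModule K M)
    (hpM : ∀ m : M, p • m = 0) (hcard : Nat.card M = p)
    {S : Finset (Place K)}
    (hS : ∀ v : HeightOneSpectrum (𝓞 K), (Sum.inr v : Place K) ∉ S →
      ((p : ℕ) : 𝓞 K) ∉ v.asIdeal ∧ GaloisRep.IsUnramifiedAt v ρ)
    (t : Π v : Place K, galoisCohomology (ρ.toLocal v) 1)
    (horth : ∀ y : galoisCohomology (ρ.tateDual p) 1,
      (∀ v : HeightOneSpectrum (𝓞 K), (Sum.inr v : Place K) ∉ S →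
        galoisCohomology.localization (ρ.tateDual p) (Sum.inr v) 1 y ∈
          unramifiedSubgroup (GaloisRep.toLocal v (ρ.tateDual p)) 1) →
      ∑ v ∈ S, localTatePairingZMod ρ p v (LocalInvariants.canonical K p v) (t v)
        (galoisCohomology.localization (ρ.tateDual p) v 1 y) = 0) :
    ∃ x : galoisCohomology ρ 1,
      (∀ v : HeightOneSpectrum (𝓞 K), (Sum.inr v : Place K) ∉ S →
        galoisCohomology.localization ρ (Sum.inr v) 1 x ∈ unramifiedSubgroup (GaloisRep.toLocal v ρ) 1) ∧
      ∀ v ∈ S, galoisCohomology.localization ρ v 1 x = t v := by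
  haveI : NeZero p := ⟨hp.out.ne_zero⟩
  -- the open normal subgroup `U` and the `p`-Sylow fixed field `K'' = K̄^H`
  haveI : (jointKer (p := p) ρ).Normal := MonoidHom.normal_ker _
  obtain ⟨H, hH, hcop, -, hpowres⟩ :=
    exists_fixedField_coprime_pow_mem' (p := p) (jointKer (p := p) ρ) (isOpen_jointKer ρ)
  haveI : FiniteDimensional K (IntermediateField.fixedField H : IntermediateField K (AlgebraicClosure K)) :=
    finiteDimensional_fixedField_of_isOpen H hH
  haveI : NumberField (IntermediateField.fixedField H : IntermediateField K (AlgebraicClosure K)) :=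
    NumberField.of_module_finite K _
  -- `Γ_{K''}` acts trivially on `M` (order `p`, automorphisms of `p`-power order)
  have htriv : ∀ (σ : absoluteGaloisGroup (IntermediateField.fixedField H : IntermediateField K (AlgebraicClosure K)))
      (m : M), (ρ.restrictField (IntermediateField.fixedField H : IntermediateField K (AlgebraicClosure K))) σ m = m :=
    fun σ m => by
    obtain ⟨k, hk⟩ := hpowres σ
    have hu : (ρ.toRepresentation.asGroupHom (absGaloisRestrict K
        (IntermediateField.fixedField H : IntermediateField K (AlgebraicClosure K)) σ)) ^ (p ^ k) = 1 := by
      rw [← map_pow]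
      exact Units.ext (LinearMap.ext fun m => by
        rw [Representation.asGroupHom_apply]; exact ((mem_jointKer_iff (p := p) ρ _).mp hk).1 m)
    have h := units_apply_eq_self_of_pow_eq_one hcard _ hu m
    rwa [Representation.asGroupHom_apply] at h
  -- the descent, with Milne I 4.10(b) for the trivial module over `K''`
  refine middleExact_canonical_of_descentData (K' := (IntermediateField.fixedField H :
      IntermediateField K (AlgebraicClosure K))) ρ (ρ.restrictField _) hpM hcop
    (galoisCohomology.cor ρ _) (globalCorDual (p := p) ρ)
    (fun v w => localCor v w ρ) (fun v w => localRes v w ρ) (fun v w => localCorDual (p := p) ρ v w)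
    (fun v y' => localization_cor_eq_sum_localCor v ρ y')
    (fun v y' => localization_globalCorDual_eq_sum_localCorDual v ρ y')
    (fun v a => sum_localCor_localRes v ρ a)
    (fun v w a b' => localTatePairingZMod_localRes_eq_localCorDual (p := p) ρ v w a b')
    (fun v w z' hz' => localCor_mem_unramifiedSubgroup v w ρ z' hz')
    (fun v w z' hz' => localCorDual_mem_unramifiedSubgroup (p := p) ρ v w z' hz')
    (fun v w h => isUnramifiedAt_restrictField_place ρ v w h)
    (fun winf a => galoisCohomology_toLocal_inl_eq_zero_of_odd ρ hodd hpM winf a)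
    (fun S' hS'inf hS' t' horth' => ?_) hS t horth
  exact middleExact_canonical_of_trivial_of_card_eq (fun _ _ => hodd) (ρ.restrictField _) htriv hcard S' hS'inf
    (fun w hw => (hS' w hw).1) t' horth'

end Main

end Summit.BirchSwinnertonDyer.BirchSwinnertonDyer.Theorems.KolyvaginRoadThreePT

end
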